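import Mathlib
import HarnessLib
import Summits.NavierStokesRegularity.NavierStokesRegularity.Theorems.UnthreadedRigidityDoorUnthreadedRigidityVirialHornDefs

/-!
# Route `UnthreadedRigidityDoor`, item `UnthreadedRigidity` (W2, stmt-NavierStokesRegularity-27585) — LINE g11-1 «VIRIAL HORN»:
# S-A `AnalyticWedgeSeparableL` BY NAME — analytic coefficient profiles with all Wronskians zero are proportional, so an
# isotypic datum is one separable shell

Prover file (W2 Lean hand ns-crc-p1 g7, DIRECTOR-NS KEY-NS #188 (1); `--supports stmt-NavierStokesRegularity-27585 --as helper`) for LINE g11-1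
«VIRIAL HORN» of planner ns-idea-6 g11 (idea-crit-4 g7 PASS, RUNG line, 2026-08-29T03:44Z; sketch
`pub/ideators/ns-idea-6/lines/UnthreadedRigidityDoor/VirialHorn_sketch.lean` sha16 046ceb385f972470; objects BY NAME in
`Theorems/UnthreadedRigidityDoorUnthreadedRigidityVirialHornDefs.lean`).

`analyticWedgeSeparableL_holds : AnalyticWedgeSeparableL`.  Proof: if every profile vanishes on `(0,∞)` the datum is the zero shell
(`H = 0`, `Y = 0`).  Otherwise pick `m₀, r₀ > 0` with `c_{m₀}(r₀) ≠ 0`; for each `m` the quotient `(c_m − λ_m c_{m₀})/c_{m₀}`,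
`λ_m = c_m(r₀)/c_{m₀}(r₀)`, has zero derivative near `r₀` (the Wronskian), so `c_m − λ_m c_{m₀}` vanishes near `r₀` and hence on all of
`(0,∞)` by the identity theorem for real-analytic functions (`AnalyticOnNhd.eqOn_zero_of_preconnected_of_eventuallyEq_zero`); then
`Σ c_m(|y|) B_m(y) = c_{m₀}(|y|) · Σ λ_m B_m(y)` for `y ≠ 0` (and both sides are multiplied by `y = 0` at the centre), and `Y = Σ λ_m B_m`
is a solid harmonic of degree `l` (homogeneous polynomials of degree `l` form a subspace; `lap3` is linear on `C²` polynomial maps).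

HONEST LABEL: real analysis / algebra about SPECIAL isotypic data (support S-A of a RUNG line); `UnthreadedRigidity` (27585), W2 and NS
regularity remain OPEN; nothing here is a statement about the Navier–Stokes equations.  0 kit.
-/

-- the summit and its single sub-problem share the name (CONVENTIONS §1), as in every Theorems file
set_option linter.dupNamespace false

namespace Summit.NavierStokesRegularity.NavierStokesRegularity.Theorems.UnthreadedRigidity.VirialHorn

open scoped Topology ContDiff
open Filter Set
open Summit.NavierStokesRegularity.NavierStokesRegularity.Theorems.UnthreadedRigidity.ProfileHorn (E3)

/-! ## Polynomial maps are smooth; solid harmonics form a subspace -/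

/-- evaluation of a real polynomial in the coordinates is a smooth map on `E3`. -/
theorem contDiff_eval (P : MvPolynomial (Fin 3) ℝ) :
    ContDiff ℝ ∞ (fun y : E3 => MvPolynomial.eval (fun i => y i) P) := by
  induction P using MvPolynomial.induction_on with
  | C a => simpa using contDiff_const
  | add p q hp hq => simpa [map_add] using hp.add hq
  | mul_X p i hp =>
    -- the coordinate functions are smooth (the tree's idiom, e.g. `…ConstantSpeedExample.contDiff_coord`)
    have hc : ContDiff ℝ ∞ (fun y : E3 => y i) := (EuclideanSpace.proj i : E3 →L[ℝ] ℝ).contDiff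
    simpa [map_mul, MvPolynomial.eval_X] using hp.mul hc

/-- a solid harmonic is a smooth map. -/
theorem IsSolidHarmonic.contDiff {l : ℕ} {Y : E3 → ℝ} (hY : IsSolidHarmonic l Y) : ContDiff ℝ ∞ Y := by
  obtain ⟨⟨P, -, hP⟩, -⟩ := hY
  have : Y = fun y : E3 => MvPolynomial.eval (fun i => y i) P := funext hP
  rw [this]
  exact contDiff_eval P

/-- first directional derivatives of a linear combination of `C¹` functions. -/
theorem fderiv_comb_apply {n : ℕ} (v : Fin n → ℝ) (B : Fin n → E3 → ℝ) (hB : ∀ m, Differentiable ℝ (B m))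
    (z w : E3) : fderiv ℝ (fun y => ∑ m, v m * B m y) z w = ∑ m, v m * fderiv ℝ (B m) z w := by
  have h1 : (fun y => ∑ m, v m * B m y) = ∑ m, (fun y => v m * B m y) := by
    funext y; simp [Finset.sum_apply]
  rw [h1, fderiv_sum fun m _ => ((hB m).const_mul (v m)) z]
  simp only [FunLike.coe_sum, Finset.sum_apply]
  refine Finset.sum_congr rfl fun m _ => ?_
  rw [fderiv_const_mul ((hB m) z)]
  rfl

/-- `lap3` is linear on `C²` functions. -/
theorem lap3_comb {n : ℕ} (v : Fin n → ℝ) (B : Fin n → E3 → ℝ) (hB : ∀ m, ContDiff ℝ 2 (B m)) (y : E3) :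
    lap3 (fun y => ∑ m, v m * B m y) y = ∑ m, v m * lap3 (B m) y := by
  have hd : ∀ m, Differentiable ℝ (B m) := fun m => (hB m).differentiable (by norm_num)
  have hd2 : ∀ m (w : E3), Differentiable ℝ (fun z => fderiv ℝ (B m) z w) := fun m w =>
    (((hB m).fderiv_right (m := 1) (by norm_num)).differentiable (by norm_num)).clm_apply (differentiable_const w)
  unfold lap3 dir2
  have step : ∀ w : E3, (fun z => fderiv ℝ (fun y => ∑ m, v m * B m y) z w) = fun z => ∑ m, v m * fderiv ℝ (B m) z w :=
    fun w => funext fun z => fderiv_comb_apply v B hd z w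
  simp only [step]
  have step2 : ∀ w : E3, fderiv ℝ (fun z => ∑ m, v m * fderiv ℝ (B m) z w) y w = ∑ m, v m * fderiv ℝ (fun z => fderiv ℝ (B m) z w) y w :=
    fun w => fderiv_comb_apply v (fun m z => fderiv ℝ (B m) z w) (fun m => hd2 m w) y w
  simp only [step2]
  rw [Finset.sum_comm]
  refine Finset.sum_congr rfl fun m _ => ?_
  rw [Finset.mul_sum]

/-- a linear combination of solid harmonics of degree `l` is a solid harmonic of degree `l`. -/
theorem isSolidHarmonic_comb {l n : ℕ} (v : Fin n → ℝ) (B : Fin n → E3 → ℝ) (hB : ∀ m, IsSolidHarmonic l (B m)) :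
    IsSolidHarmonic l (fun y => ∑ m, v m * B m y) := by
  choose P hPh hPe using fun m => (hB m).1
  refine ⟨⟨∑ m, MvPolynomial.C (v m) * P m, ?_, fun y => ?_⟩, fun y => ?_⟩
  · refine MvPolynomial.IsHomogeneous.sum _ _ l fun m _ => ?_
    simpa using (MvPolynomial.isHomogeneous_C (Fin 3) (v m)).mul (hPh m)
  · simp [map_sum, map_mul, hPe]
  · rw [lap3_comb v B (fun m => (hB m).contDiff.of_le (WithTop.coe_le_coe.mpr le_top)) y]
    simp [fun m => (hB m).2 y]

/-- the zero function is a solid harmonic of every degree. -/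
theorem isSolidHarmonic_zero (l : ℕ) : IsSolidHarmonic l (fun _ : E3 => (0 : ℝ)) := by
  refine ⟨⟨0, MvPolynomial.isHomogeneous_zero _ _ l, fun y => by simp⟩, fun y => ?_⟩
  simp [lap3, dir2]

/-- the zero profile is virial-admissible in every degree. -/
theorem virialAdmissible_zero (l : ℕ) : VirialAdmissible l (fun _ : ℝ => (0 : ℝ)) := by
  refine ⟨⟨fun _ => 0, contDiff_const, fun r _ => rfl⟩, 0, fun r _ => ?_⟩
  simp

/-! ## Analytic functions with zero Wronskian are proportional -/

/-- on `(0,∞)`: real-analytic `f, g` with `f g′ − g f′ ≡ 0` and `f(r₀) ≠ 0` at some `r₀ > 0` satisfy `g = λ f` for a constant `λ`. -/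
theorem exists_const_mul_of_wronskian {f g : ℝ → ℝ} (hf : AnalyticOnNhd ℝ f (Ioi 0)) (hg : AnalyticOnNhd ℝ g (Ioi 0))
    (hW : ∀ r, 0 < r → f r * deriv g r - g r * deriv f r = 0) {r₀ : ℝ} (hr₀ : 0 < r₀) (hf0 : f r₀ ≠ 0) :
    ∃ c : ℝ, ∀ r, 0 < r → g r = c * f r := by
  set c : ℝ := g r₀ / f r₀ with hc
  refine ⟨c, ?_⟩
  set φ : ℝ → ℝ := fun r => g r - c * f r with hφ
  have hφa : AnalyticOnNhd ℝ φ (Ioi 0) := fun r hr => (hg r hr).sub (analyticAt_const.mul (hf r hr))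
  have hφ0 : φ r₀ = 0 := by
    simp only [hφ, hc]
    field_simp
    ring
  -- a closed interval around `r₀` inside `(0,∞)` on which `f ≠ 0`
  have hev : ∀ᶠ r in 𝓝 r₀, 0 < r ∧ f r ≠ 0 :=
    (eventually_gt_nhds hr₀).and ((hf r₀ hr₀).continuousAt.eventually_ne hf0)
  obtain ⟨ε, hε, hball⟩ := Metric.mem_nhds_iff.mp hev
  set δ : ℝ := ε / 2 with hδ
  have hδ0 : 0 < δ := by positivity
  have hIcc : Icc (r₀ - δ) (r₀ + δ) ⊆ Metric.ball r₀ ε := by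
    intro r hr
    rw [Metric.mem_ball, Real.dist_eq, abs_lt]
    constructor <;> linarith [hr.1, hr.2]
  have hgood : ∀ r ∈ Icc (r₀ - δ) (r₀ + δ), 0 < r ∧ f r ≠ 0 := fun r hr => hball (hIcc hr)
  -- the quotient `φ / f` is constant on that interval
  have hder : ∀ x ∈ Icc (r₀ - δ) (r₀ + δ), HasDerivAt (fun r => φ r / f r) 0 x := by
    intro x hx
    obtain ⟨hx0, hfx⟩ := hgood x hx
    have hfd : HasDerivAt f (deriv f x) x := (hf x hx0).differentiableAt.hasDerivAt
    have hgd : HasDerivAt g (deriv g x) x := (hg x hx0).differentiableAt.hasDerivAt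
    have hφd : HasDerivAt φ (deriv g x - c * deriv f x) x := hgd.sub (hfd.const_mul c)
    have key := hφd.div hfd hfx
    have hnum : (deriv g x - c * deriv f x) * f x - φ x * deriv f x = 0 := by
      simp only [hφ]
      linear_combination hW x hx0
    rw [hnum, zero_div] at key
    exact key
  have hcont : ContinuousOn (fun r => φ r / f r) (Icc (r₀ - δ) (r₀ + δ)) :=
    fun x hx => (hder x hx).continuousAt.continuousWithinAt
  have hconst := constant_of_has_deriv_right_zero hcont
    (fun x hx => (hder x (Ico_subset_Icc_self hx)).hasDerivWithinAt)
  have hq0 : φ r₀ / f r₀ = 0 := by rw [hφ0, zero_div]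
  have hr₀mem : r₀ ∈ Icc (r₀ - δ) (r₀ + δ) := ⟨by linarith, by linarith⟩
  have hφI : ∀ r ∈ Icc (r₀ - δ) (r₀ + δ), φ r = 0 := by
    intro r hr
    have h1 : φ r / f r = φ r₀ / f r₀ := by rw [hconst r hr, hconst r₀ hr₀mem]
    rw [hq0] at h1
    rcases div_eq_zero_iff.mp h1 with h2 | h2
    · exact h2
    · exact absurd h2 (hgood r hr).2
  -- identity theorem on the preconnected set `(0,∞)`
  have hφev : φ =ᶠ[𝓝 r₀] 0 := by
    filter_upwards [Icc_mem_nhds (by linarith : r₀ - δ < r₀) (by linarith : r₀ < r₀ + δ)] with r hr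
    exact hφI r hr
  have hzero := hφa.eqOn_zero_of_preconnected_of_eventuallyEq_zero isPreconnected_Ioi hr₀ hφev
  intro r hr
  have := hzero hr
  simp only [hφ, Pi.zero_apply] at this
  linarith

/-! ## S-A -/

/-- **S-A `AnalyticWedgeSeparableL` BY NAME** (support S of LINE g11-1): analytic coefficient profiles with all Wronskians zero are proportional
to one profile (`c_m = v_m H`), so the isotypic datum is a single separable shell with `Y = Σ v_m B_m ∈ V_l`. -/
theorem analyticWedgeSeparableL_holds : AnalyticWedgeSeparableL := by
  intro l n c B x₀ hIso hAn hW
  obtain ⟨hB, hc⟩ := hIso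
  by_cases hex : ∃ m : Fin n, ∃ r : ℝ, 0 < r ∧ c m r ≠ 0
  · obtain ⟨m₀, r₀, hr₀, hne⟩ := hex
    have hprop : ∀ m, ∃ v : ℝ, ∀ r, 0 < r → c m r = v * c m₀ r := fun m =>
      exists_const_mul_of_wronskian (hAn m₀) (hAn m) (fun r hr => hW m₀ m r hr) hr₀ hne
    choose v hv using hprop
    refine ⟨c m₀, fun y => ∑ m, v m * B m y, hc m₀, isSolidHarmonic_comb v B hB, ?_⟩
    unfold isoShellL sepShellL
    have e : (fun x : E3 => (∑ m, c m ‖x - x₀‖ * B m (x - x₀)) • (x - x₀))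
        = fun x : E3 => (c m₀ ‖x - x₀‖ * ∑ m, v m * B m (x - x₀)) • (x - x₀) := by
      funext x
      by_cases hx : x - x₀ = 0
      · simp [hx]
      · have hr : 0 < ‖x - x₀‖ := norm_pos_iff.mpr hx
        congr 1
        rw [Finset.mul_sum]
        refine Finset.sum_congr rfl fun m _ => ?_
        rw [hv m _ hr]
        ring
    rw [e]
  · have hex' : ∀ m : Fin n, ∀ r : ℝ, 0 < r → c m r = 0 := fun m r hr => by
      by_contra hne
      exact hex ⟨m, r, hr, hne⟩
    refine ⟨fun _ => 0, fun _ => 0, virialAdmissible_zero l, isSolidHarmonic_zero l, ?_⟩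
    unfold isoShellL sepShellL
    have e : (fun x : E3 => (∑ m, c m ‖x - x₀‖ * B m (x - x₀)) • (x - x₀))
        = fun x : E3 => ((0 : ℝ) * (0 : ℝ)) • (x - x₀) := by
      funext x
      by_cases hx : x - x₀ = 0
      · simp [hx]
      · have hr : 0 < ‖x - x₀‖ := norm_pos_iff.mpr hx
        simp [hex' _ _ hr]
    rw [e]

end Summit.NavierStokesRegularity.NavierStokesRegularity.Theorems.UnthreadedRigidity.VirialHorn
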